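import Summits.NavierStokesRegularity.FluidComputer.PalasekTowerFaceNumbers

/-!
# The τ₁ faces of the register as universal Navier–Stokes constants, V: anchored gradient faces and the SECOND window
# in level-`0` anchored units, CERTIFIED (crux `EpisodeBase`, stmt-NavierStokesRegularity-19179; used by 19249's census)

Cell `ns-blowup`, seat `ns-palasek-19179-p2` (g4; holder of record of the crux `EpisodeBase` = `EpisodeBaseG` of the route
`PalasekTowerBreakdown`, line `slot`). Sequel of `PalasekTowerFaceNumbers.lean` (`…UniversalFace`, §1–§4), which certified the
level-`0` face numbers in anchored / start / ceiling units. Two registered MODEL instruments of the cell read further numbers in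
the SAME anchored unit system (speed unit `Y₀`, `ν = 1`, length `ν/Y₀`, time `ν/Y₀²`, gradient `Y₀²/ν`):

* the stage-A instrument «OPT-𝔄-1» (PREREG v1.2 `79d8041a70984a89`) prints the window-`0` GRADIENT face as `‖∇u(s₀)‖ / 0.678`;
* the rider «E3-OPT-RIDER» (PREREG v1 `f6661abe4d28c4ac`, strategist `ns-palasek-19249-cstrat-1` g4; crux stmt-…-19249 `HeredityAtOne`)
  continues a window-`0` design through window `1` and reads the level-`2` letter as «window 1 = `W₁Y₀² = 99.9`, level-2 floor
  `Y₂/Y₀ = 4.542`, ceiling `c₂Y₂/Y₀ = 7.570`, gradient face `A₂/(Y₀²/ν) = 2.757`».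

This file CERTIFIES decimal brackets for those constants: `gradAnch 0 = A₁/Y₀² ∈ (0.6782, 0.6784)`, `gradAnch 1 = A₂/Y₀² ∈
(2.7586, 2.7591)`, `floorAnchTwo = Y₂/Y₀ ∈ (4.543, 4.545)`, `runAnchTwo = (5/3)Y₂/Y₀ ∈ (7.572, 7.575)`, `window 1 = (61226/625)·log 2/A₁`,
`windowOneAnch = window 1 · Y₀² ∈ (100.0, 100.2)`. CUSTODY REMARK (numbers, not adjectives): the rider's printed constants are rounded
versions — `4.542 < 4.543` (its level-2 speed test is lenient by `< 0.03 %`), `7.570 < 7.572` (its ceiling test is strict by `< 0.03 %`),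
`2.757 < 2.7586` (gradient test lenient by `< 0.06 %`), and its window length `99.9` is `0.2 %` SHORT of `windowOneAnch ∈ (100.0, 100.2)`; none
of these can move a MODEL word, and the RESULT lines quote this file. LABEL: E–C typing (KERNEL, certified arithmetic). WHAT THIS IS NOT:
not Navier–Stokes evidence — arithmetic of the REGISTER's constants (wide rates `N₀ = 256`, `b = 11/10`, `β = 23/10`); nothing about
any flow, about `EpisodeBase`, `HeredityAtOne` or blow-up.

References: S. Palasek, arXiv:2605.13827 §3.3 [cite: Palasek2026ElementaryModel, §3.3].
-/

noncomputable section

namespace Summit.NavierStokesRegularity.FluidComputer.PalasekTowerClayBridge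

open Set MeasureTheory Filter Topology Function
open scoped ENNReal ContDiff NNReal
open Literature.Analysis.FluidPDE

namespace UniversalFace

open TowerRates

/-! ## §5 Anchored gradient faces (`‖∇u‖` unit `Y₀²/ν`) -/

/-- **Gradient face of window `k` in level-`0` anchored units**: `gradAnch k = A_{k+1} / Y₀²` (the strain floor the level-`k+1`
letter asks at `τ_{k+1}`, in units of `Y₀²/ν`). [cite: Palasek2026ElementaryModel, §3.3] -/
def gradAnch (k : ℕ) : ℝ := TowerRates.wide.A (k + 1) / TowerRates.wide.Y 0 ^ 2

/-- `Y₀² ∈ (1351.1², 1351.2²)`. [folklore] -/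
theorem wide_Y_zero_sq_bounds : (1351.1 : ℝ) ^ 2 < wide.Y 0 ^ 2 ∧ wide.Y 0 ^ 2 < (1351.2 : ℝ) ^ 2 := by
  obtain ⟨hY1, hY2⟩ := wide_Y_zero_bounds_fine
  have hY0 : 0 < wide.Y 0 := by linarith
  constructor <;> nlinarith

/-- **Gradient face, window `0`, anchored**: `gradAnch 0 = A₁ / Y₀² ∈ (0.6782, 0.6784)` (the instruments' `0.678`). [folklore] -/
theorem gradAnch_zero_bounds : 0.6782 < gradAnch 0 ∧ gradAnch 0 < 0.6784 := by
  obtain ⟨hs1, hs2⟩ := wide_Y_zero_sq_bounds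
  obtain ⟨hA1, hA2⟩ := wide_A_one_bounds
  have h : gradAnch 0 = wide.A (0 + 1) / wide.Y 0 ^ 2 := rfl
  rw [h, zero_add]
  have hden : 0 < wide.Y 0 ^ 2 := by nlinarith
  constructor
  · rw [lt_div_iff₀ hden]; nlinarith
  · rw [div_lt_iff₀ hden]; nlinarith

/-- **Gradient face, window `1`, anchored**: `gradAnch 1 = A₂ / Y₀² ∈ (2.7586, 2.7591)` (the rider's `2.757` is the rounded
product `4.066 × 0.678`; the certified value is `≈ 2.7588`). [folklore] -/
theorem gradAnch_one_bounds : 2.7586 < gradAnch 1 ∧ gradAnch 1 < 2.7591 := by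
  obtain ⟨hs1, hs2⟩ := wide_Y_zero_sq_bounds
  obtain ⟨hA1, hA2⟩ := wide_A_two_bounds
  have h : gradAnch 1 = wide.A (1 + 1) / wide.Y 0 ^ 2 := rfl
  rw [h, one_add_one_eq_two]
  have hden : 0 < wide.Y 0 ^ 2 := by nlinarith
  constructor
  · rw [lt_div_iff₀ hden]; nlinarith
  · rw [div_lt_iff₀ hden]; nlinarith

/-- The ratio of the two anchored gradient faces is the register's strain step `A₂/A₁ ∈ (4.067, 4.068)` (the rider's `4.066`).
[folklore] -/
theorem gradAnch_one_div_zero_bounds : 4.067 < gradAnch 1 / gradAnch 0 ∧ gradAnch 1 / gradAnch 0 < 4.068 := by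
  obtain ⟨hA11, hA12⟩ := wide_A_one_bounds
  obtain ⟨hA21, hA22⟩ := wide_A_two_bounds
  obtain ⟨hY01, hY02⟩ := wide_Y_zero_bounds_fine
  have hY0 : wide.Y 0 ≠ 0 := by positivity
  have hA1 : 0 < wide.A 1 := by linarith
  have h : gradAnch 1 / gradAnch 0 = wide.A 2 / wide.A 1 := by
    have h1 : gradAnch 1 = wide.A (1 + 1) / wide.Y 0 ^ 2 := rfl
    have h0 : gradAnch 0 = wide.A (0 + 1) / wide.Y 0 ^ 2 := rfl
    rw [h1, h0, one_add_one_eq_two, zero_add, div_div_div_cancel_right₀ (pow_ne_zero 2 hY0)]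
  rw [h]
  constructor
  · rw [lt_div_iff₀ hA1]; nlinarith
  · rw [div_lt_iff₀ hA1]; nlinarith

/-! ## §6 The level-`2` letter in level-`0` anchored units (window `1` of the tower, read by the E3 rider) -/

/-- **Level-`2` speed floor in anchored units**: `floorAnchTwo = Y₂ / Y₀`. [cite: Palasek2026ElementaryModel, §3.3] -/
def floorAnchTwo : ℝ := TowerRates.wide.Y 2 / TowerRates.wide.Y 0

/-- **Level-`2` running bound in anchored units**: `runAnchTwo = c₂ Y₂ / Y₀ = (5/3) Y₂ / Y₀`.
[cite: Palasek2026ElementaryModel, §3.3] -/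
def runAnchTwo : ℝ := (5 / 3) * TowerRates.wide.Y 2 / TowerRates.wide.Y 0

/-- **Second window in anchored units**: `windowOneAnch = w₁ Y₀²` (`w₁ = window 1 = 4bβ log N₂ / A₁`).
[cite: Palasek2026ElementaryModel, §3.3] -/
def windowOneAnch : ℝ := window 1 * TowerRates.wide.Y 0 ^ 2

/-- `floorAnchTwo ∈ (4.543, 4.545)` (the rider's `4.542 = 2.056 × 2.209` is rounded below the bracket). [folklore] -/
theorem floorAnchTwo_bounds : 4.543 < floorAnchTwo ∧ floorAnchTwo < 4.545 := by
  obtain ⟨hY01, hY02⟩ := wide_Y_zero_bounds_fine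
  obtain ⟨hY21, hY22⟩ := wide_Y_two_bounds
  have hY0 : 0 < wide.Y 0 := by linarith
  have h : floorAnchTwo = wide.Y 2 / wide.Y 0 := rfl
  rw [h]
  constructor
  · rw [lt_div_iff₀ hY0]; nlinarith
  · rw [div_lt_iff₀ hY0]; nlinarith

/-- `floorAnchTwo = floorAnch · (Y₂/Y₁)`: the level-`2` floor is the level-`1` floor times the next speed step. [folklore] -/
theorem floorAnchTwo_eq : floorAnchTwo = floorAnch * (TowerRates.wide.Y 2 / TowerRates.wide.Y 1) := by
  have hY1 : TowerRates.wide.Y 1 ≠ 0 := (Y_pos 1).ne'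
  have h2 : floorAnchTwo = wide.Y 2 / wide.Y 0 := rfl
  have h1 : floorAnch = wide.Y 1 / wide.Y 0 := rfl
  rw [h2, h1]
  field_simp

/-- `runAnchTwo ∈ (7.572, 7.575)` (the rider's ceiling `7.570` is rounded below the bracket). [folklore] -/
theorem runAnchTwo_bounds : 7.572 < runAnchTwo ∧ runAnchTwo < 7.575 := by
  obtain ⟨hY01, hY02⟩ := wide_Y_zero_bounds_fine
  obtain ⟨hY21, hY22⟩ := wide_Y_two_bounds
  have hY0 : 0 < wide.Y 0 := by linarith
  have h : runAnchTwo = (5 / 3) * wide.Y 2 / wide.Y 0 := rfl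
  rw [h]
  constructor
  · rw [lt_div_iff₀ hY0]; nlinarith
  · rw [div_lt_iff₀ hY0]; nlinarith

/-- `runAnchTwo = (5/3) · floorAnchTwo` (`c₂ = 5/3`). [folklore] -/
theorem runAnchTwo_eq : runAnchTwo = (5 / 3) * floorAnchTwo := by
  simp only [runAnchTwo, floorAnchTwo]
  ring

/-- **Closed form of the second window**: `w₁ = 4bβ log N₂ / A₁ = (61226/625) · log 2 / A₁`
(`4 · (11/10) · (23/10) · (242/25) = 61226/625 = 97.9616`). [cite: Palasek2026ElementaryModel, §3.3] -/
theorem window_one_eq : window 1 = (61226 / 625) * Real.log 2 / wide.A 1 := by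
  have h : window 1 = 4 * wide.b * wide.β * Real.log (wide.N (1 + 1)) / wide.A 1 := rfl
  rw [h, one_add_one_eq_two, wide_log_N_two, wide_b, wide_β]
  ring

/-- `w₁ ∈ (5.4831e-5, 5.4833e-5)`. [folklore] -/
theorem window_one_bounds : (54831 : ℝ) / 10 ^ 9 < window 1 ∧ window 1 < 54833 / 10 ^ 9 := by
  rw [window_one_eq]
  obtain ⟨hA1, hA2⟩ := wide_A_one_bounds
  have hl1 := Real.log_two_gt_d9
  have hl2 := Real.log_two_lt_d9
  have hA : 0 < wide.A 1 := by linarith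
  constructor
  · rw [lt_div_iff₀ hA]; nlinarith
  · rw [div_lt_iff₀ hA]; nlinarith

/-- **Second window, anchored**: `windowOneAnch = w₁ Y₀² ∈ (100.0, 100.2)` viscous times of the anchor (the rider's `99.9` is
`0.2 %` short). [folklore] -/
theorem windowOneAnch_bounds : 100.0 < windowOneAnch ∧ windowOneAnch < 100.2 := by
  obtain ⟨hw1, hw2⟩ := window_one_bounds
  obtain ⟨hsq1, hsq2⟩ := wide_Y_zero_sq_bounds
  have h : windowOneAnch = window 1 * wide.Y 0 ^ 2 := rfl
  have hw0 : 0 < window 1 := by linarith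
  rw [h]
  constructor
  · have := mul_lt_mul'' hw1 hsq1 (by norm_num) (by norm_num)
    linarith
  · have := mul_lt_mul'' hw2 hsq2 hw0.le (by positivity)
    linarith

/-- The two windows together: `windowAnch + windowOneAnch ∈ (425.7, 426.1)` anchor viscous times from `τ₀` to `τ₂`
(the rider's `s₂ = 425.7` sits at the lower end). [folklore] -/
theorem windowAnch_add_windowOneAnch_bounds :
    425.7 < windowAnch + windowOneAnch ∧ windowAnch + windowOneAnch < 426.1 := by
  obtain ⟨h01, h02⟩ := windowAnch_bounds
  obtain ⟨h11, h12⟩ := windowOneAnch_bounds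
  constructor <;> linarith

/-- The second window is SHORTER than the first in anchor units: `windowOneAnch / windowAnch ∈ (0.3068, 0.3077)`
(`= w₁/w₀ = b · A₀/A₁`). [folklore] -/
theorem windowOneAnch_div_windowAnch_bounds :
    0.3068 < windowOneAnch / windowAnch ∧ windowOneAnch / windowAnch < 0.3077 := by
  obtain ⟨h01, h02⟩ := windowAnch_bounds
  obtain ⟨h11, h12⟩ := windowOneAnch_bounds
  have h0 : 0 < windowAnch := by linarith
  constructor
  · rw [lt_div_iff₀ h0]; nlinarith
  · rw [div_lt_iff₀ h0]; nlinarith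

end UniversalFace

end Summit.NavierStokesRegularity.FluidComputer.PalasekTowerClayBridge

end
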